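import Summits.CriticalPhenomena.CardyFormulaZ2.Theorems.CardyComplexConeSLESixFamiliesGiveCardyRotate
import Summits.CriticalPhenomena.CardyFormulaZ2.Theorems.CardyComplexConeSLESixFamiliesGiveCardyUpperFence
import Summits.CriticalPhenomena.CardyFormulaZ2.Theorems.CardyComplexConeSLESixFamiliesGiveCardyLowerRun
import Summits.CriticalPhenomena.CardyFormulaZ2.Theorems.CardyComplexConeSLESixFamiliesGiveCardyTouchLimsup
import Summits.CriticalPhenomena.CardyFormulaZ2.Theorems.CardyComplexConeSLESixFamiliesGiveCardySleSideTouch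
import Summits.CriticalPhenomena.CardyFormulaZ2.Theorems.CardyComplexConeSLESixFamiliesGiveCardyCollarDomains
import Summits.CriticalPhenomena.CardyFormulaZ2.Theorems.CardyComplexConeSLESixFamiliesGiveCardyModulusContinuity
import Summits.CriticalPhenomena.CardyFormulaZ2.Theorems.CardyComplexConeSLESixFamiliesGiveCardySmoothMarkFamilies
import Literature.Probability.RandomPlanarGeometry.CardyFunctionIncBeta
import Literature.Probability.Percolation.InterfaceCurves
import HarnessLib

/-!
# `SLESixFamiliesGiveCardy` — SLE₆ for every Dobrushin domain and every discretisation family gives Cardy's formula on `ℤ²`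

Crux `Summit.CriticalPhenomena.CardyFormulaZ2.Theses.CardyComplexCone.SLESixFamiliesGiveCardy`
(stmt-CriticalPhenomena-9654, route `CardyComplexCone`, sub-problem `CriticalPhenomena/CardyFormulaZ2`)
CLOSED by line `collar-touch-sandwich` (idea card `Ideas/collar-touch-sandwich.md`, planner
skeleton `Lines/collar-touch-sandwich.lean`, lead reshape r1): the composition of the seven landed
stubs `stub_upperFence` (A), `stub_lowerRun` (B), `stub_touchLimsup` (C), `stub_sleSideTouch` (D),
`stub_collarDomains` (E), `stub_modulusContinuity` (G), `stub_smoothMarkFamilies` (F) into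
`SLESixFamiliesGiveCardy_of : SLESixFamiliesGiveCardy`.

The line (touch-free Cardy readout through collared Dobrushin problems).  Fix a conformal
rectangle `R = (Ω; a, b, c, d)` and the FREE crossing event `C_δ = discreteCrossing Ω δ (ab) (cd)`.
The hypothesis `SLE6Families` is consumed at two DESIGNER Dobrushin domains containing `Ω`, with
marks outside `closure Ω` on smooth exterior collar arcs (E, F): `D₁ = Q₁.chord 0 1` (collars behind
`(bc)`, `(da)`; touch set `G₁ = Q₁.arc 2 ⊇ (cd)`) and `D₂ = Q₂.chord 0 3`, `Q₂ ≈ (Ω; c, d, a, b)`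
(collars behind `(ab)`, `(cd)`; `G₂ = Q₂.arc 1 ⊇ (da)`).  Deterministically and eventually in `δ`:
`C_δ ⊆ {trace γ₁ meets N̄_η G₁}` (A: Newman cross-cut) and `{trace γ₂ avoids N̄_η G₂} ⊆ C_δ`
(B: bc-open escort chain); closed-set portmanteau along `𝓝[>] 0` (C) turns these into
`P[C_δ] ≤ W[SLE₆ touches N̄_η G₁] + ε`, `P[C_δᶜ] ≤ W[SLE₆ touches N̄_η G₂] + ε`; the SLE₆ side-arc
touch law (D: Rohde–Schramm same-side law at `κ = 6`, kernel = Cardy's) gives `F(η_{Q₁})`,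
`1 - F(η_{Q₂})` as `η ↓ 0`; Radó continuity of the modulus (G) and `crossRatio_rotateTwo` make
`|F(η_{Qᵢ}) - F(η_R)| < ε`; with `P C + P Cᶜ ≥ 1` this is `|P[C_δ] - F(η_R)| < 8ε` eventually.
No hitting ORDER of a lattice curve, no a.s.-continuity, no arm exponent, no RSW (given `H`), no
orientation case split — honouring the crux Disproof's refuted transfer principles.
-/

noncomputable section

open Set Filter Topology Metric MeasureTheory
open scoped NNReal
open UpperHalfPlane (upperHalfPlaneSet)
open Literature.Probability Literature.Probability.RandomPlanarGeometry
  Literature.Probability.LatticeModels Literature.Probability.Percolation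

namespace Summit.CriticalPhenomena.CardyFormulaZ2.Cruxes.SLESixFamiliesGiveCardy.CollarTouchSandwich

/-! ### The composition (kernel-checked, no `sorry`) -/

/-- Local alias of the crux (so that `SLESixFamiliesGiveCardy_of` below is the ONLY theorem of the
file concluding the crux by name, as the skeleton audit requires). -/
def CruxStatement : Prop :=
  Summit.CriticalPhenomena.CardyFormulaZ2.Theses.CardyComplexCone.SLESixFamiliesGiveCardy

/-- **`SLESixFamiliesGiveCardy` from the seven statements.**  Given `H = SLE6Families`, a conformal
rectangle `R` and a uniformizing datum `(φ, x)`, fix `e > 0`, `ε = e/8`, a modulus `θ` of uniform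
continuity of `F` on `[0, 1]` for `ε`.  STUB G at `R` and at `rotateTwo R` (with any datum of the
latter, whose cross-ratio is that of `x` by `crossRatio_rotateTwo`) gives closeness tolerances
`ε₁, ε₂`; STUB E at `min ε₁ ε₂` gives collared rectangles `Q₁`, `Q₂` (geometries, smooth marks,
loops and marks close to those of `R`, resp. of `rotateTwo R`), hence every datum of `Q₁`, `Q₂` has
cross-ratio within `θ/2` of `crossRatio x`; STUB F gives discretisation families `Λ₁`, `Λ₂` of
`D₁ = Q₁.chord 0 1`, `D₂ = Q₂.chord 0 3`; `H` at `(D₁, Λ₁)`, `(D₂, Λ₂)` gives SLE₆ random curves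
`Γ₁`, `Γ₂` with the interfaces converging in law; STUB D gives `η₁, η₂ > 0` with
`Law(Γ₁)(touch N̄_{η₁} Q₁.arc 2) < F(η_{Q₁}) + ε` and `Law(Γ₂)(touch N̄_{η₂} Q₂.arc 1) < 1 - F(η_{Q₂}) + ε`;
STUBS A, B give the eventual inclusions `C_δ ⊆ {range γ₁ meets N̄_{η₁}}`, `C_δᶜ ⊆ {range γ₂ meets N̄_{η₂}}`
(`Interface.range_bondInterfaceIn`); STUB C turns them into `P[C_δ] ≤ F(η_{Q₁}) + 2ε`,
`P[C_δᶜ] ≤ 1 - F(η_{Q₂}) + 2ε` eventually; with `|F(η_{Qᵢ}) - F(η_R)| < ε` and `P C + P Cᶜ ≥ 1` this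
is `|P[C_δ] - F(η_R)| < e` eventually. -/
theorem cardy_of_statements (hU : UpperFence) (hL : LowerRun) (hP : TouchLimsup) (hS : SleSideTouch)
    (hG : CollarDomains) (hM : ModulusContinuity) (hF : SmoothMarkFamilies) : CruxStatement := by
  intro H R φ x hux
  rw [Metric.tendsto_nhds]
  intro e he
  -- tolerances
  set ε : ℝ := e / 8 with hε8
  have hε : 0 < ε := by positivity
  have hηI : crossRatio x ∈ Icc (0 : ℝ) 1 :=
    Ioo_subset_Icc_self (ConformalRectangle.crossRatio_mem_Ioo_of_isUniformizing hux)
  have hUC : UniformContinuousOn RandomPlanarGeometry.cardyFunction (Icc (0 : ℝ) 1) :=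
    isCompact_Icc.uniformContinuousOn_of_continuous continuousOn_cardyFunction_holds
  obtain ⟨θ, hθ, hθF⟩ := Metric.uniformContinuousOn_iff.1 hUC ε hε
  -- STUB G: closeness tolerances for `R` and for `rotateTwo R`
  obtain ⟨φ'', x'', hux''⟩ := MarkedDomain.exists_isUniformizing_holds (rotateTwo R)
  have hrot : crossRatio x'' = crossRatio x := crossRatio_rotateTwo hux hux''
  obtain ⟨ε₁, hε₁, hM₁⟩ := hM R φ x hux (θ / 2) (half_pos hθ)
  obtain ⟨ε₂, hε₂, hM₂⟩ := hM (rotateTwo R) φ'' x'' hux'' (θ / 2) (half_pos hθ)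
  -- STUB E: the two collared comparison rectangles
  obtain ⟨⟨Q₁, c₁, hgeo₁, hm₁₀, hm₁₁, hcl₁, hmk₁⟩, ⟨Q₂, c₂, hgeo₂, hm₂₀, hm₂₁, hcl₂, hk₀, hk₁, hk₂, hk₃⟩⟩ :=
    hG R (min ε₁ ε₂) (lt_min hε₁ hε₂)
  -- moduli: every datum of `Q₁`, `Q₂` has cross-ratio within `θ/2` of `crossRatio x`
  have hmod₁ : ∀ (φ' : ConformalEquiv upperHalfPlaneSet Q₁.carrier) (x' : Fin 4 → ℝ),
      Q₁.IsUniformizing φ' x' → |crossRatio x' - crossRatio x| ≤ θ / 2 :=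
    hM₁ Q₁ c₁ (fun s ↦ (hcl₁ s).trans (min_le_left _ _)) (fun i ↦ (hmk₁ i).trans (min_le_left _ _))
  have hmod₂ : ∀ (φ' : ConformalEquiv upperHalfPlaneSet Q₂.carrier) (x' : Fin 4 → ℝ),
      Q₂.IsUniformizing φ' x' → |crossRatio x' - crossRatio x| ≤ θ / 2 := by
    intro φ' x' h'
    rw [← hrot]
    refine hM₂ Q₂ (c₂ - R.mark 2) (fun s ↦ ?_) (fun i ↦ ?_) φ' x' h'
    · rw [boundary_rotateTwo, show s + (c₂ - R.mark 2) + R.mark 2 = s + c₂ by ring]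
      exact (hcl₂ s).trans (min_le_right _ _)
    · fin_cases i
      · show |Q₂.mark 0 + (c₂ - R.mark 2) - 0| ≤ ε₂
        rw [show Q₂.mark 0 + (c₂ - R.mark 2) - 0 = Q₂.mark 0 + c₂ - R.mark 2 by ring]
        exact hk₀.trans (min_le_right _ _)
      · show |Q₂.mark 1 + (c₂ - R.mark 2) - (R.mark 3 - R.mark 2)| ≤ ε₂
        rw [show Q₂.mark 1 + (c₂ - R.mark 2) - (R.mark 3 - R.mark 2) = Q₂.mark 1 + c₂ - R.mark 3 by ring]
        exact hk₁.trans (min_le_right _ _)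
      · show |Q₂.mark 2 + (c₂ - R.mark 2) - (R.mark 0 + 1 - R.mark 2)| ≤ ε₂
        rw [show Q₂.mark 2 + (c₂ - R.mark 2) - (R.mark 0 + 1 - R.mark 2) =
          Q₂.mark 2 + c₂ - (R.mark 0 + 1) by ring]
        exact hk₂.trans (min_le_right _ _)
      · show |Q₂.mark 3 + (c₂ - R.mark 2) - (R.mark 1 + 1 - R.mark 2)| ≤ ε₂
        rw [show Q₂.mark 3 + (c₂ - R.mark 2) - (R.mark 1 + 1 - R.mark 2) =
          Q₂.mark 3 + c₂ - (R.mark 1 + 1) by ring]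
        exact hk₃.trans (min_le_right _ _)
  -- STUB F: discretisation families of the two designer Dobrushin domains
  obtain ⟨Λ₁, hΛ₁⟩ := hF (Q₁.chord 0 1 (by decide)) hm₁₀ hm₁₁
  obtain ⟨Λ₂, hΛ₂⟩ := hF (Q₂.chord 0 3 (by decide)) hm₂₀ hm₂₁
  -- `H` at the two designer domains: SLE₆ random curves and convergence in law
  obtain ⟨Γ₁, hΓ₁, hmeas₁, hlaw₁⟩ := H (Q₁.chord 0 1 (by decide)) Λ₁ hΛ₁.Ω_eq hΛ₁.δ_eq
    hΛ₁.tendsto_arcA hΛ₁.tendsto_arcB hΛ₁.tendsto_zdABEdges hΛ₁.eventually_isZdAdmissible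
  obtain ⟨Γ₂, hΓ₂, hmeas₂, hlaw₂⟩ := H (Q₂.chord 0 3 (by decide)) Λ₂ hΛ₂.Ω_eq hΛ₂.δ_eq
    hΛ₂.tendsto_arcA hΛ₂.tendsto_arcB hΛ₂.tendsto_zdABEdges hΛ₂.eventually_isZdAdmissible
  -- the interface maps of `H` are the fact-free `Interface.bondInterfaceIn` (definitionally)
  have hmeas₁' : ∀ᶠ δ : ℝ in 𝓝[>] 0,
      AEMeasurable (fun ω => Interface.bondInterfaceIn (Q₁.chord 0 1 (by decide)) (Λ₁ δ) ω)
        (bondPercolation (zdGraph 2) Percolation.half) := hmeas₁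
  have hlaw₁' : TendstoLaw (Ωδ := fun _ => BondConfig (Site 2))
      (fun δ ω => Interface.bondInterfaceIn (Q₁.chord 0 1 (by decide)) (Λ₁ δ) ω)
      (fun _ => bondPercolation (zdGraph 2) Percolation.half) Γ₁ Process.preWienerMeasure := hlaw₁
  have hmeas₂' : ∀ᶠ δ : ℝ in 𝓝[>] 0,
      AEMeasurable (fun ω => Interface.bondInterfaceIn (Q₂.chord 0 3 (by decide)) (Λ₂ δ) ω)
        (bondPercolation (zdGraph 2) Percolation.half) := hmeas₂
  have hlaw₂' : TendstoLaw (Ωδ := fun _ => BondConfig (Site 2))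
      (fun δ ω => Interface.bondInterfaceIn (Q₂.chord 0 3 (by decide)) (Λ₂ δ) ω)
      (fun _ => bondPercolation (zdGraph 2) Percolation.half) Γ₂ Process.preWienerMeasure := hlaw₂
  -- uniformizing data of `Q₁`, `Q₂` and the SLE₆ touch limits (STUB D)
  obtain ⟨φ₁, x₁, hux₁⟩ := MarkedDomain.exists_isUniformizing_holds Q₁
  obtain ⟨φ₂, x₂, hux₂⟩ := MarkedDomain.exists_isUniformizing_holds Q₂
  have ht₁ := (hS Q₁ φ₁ x₁ hux₁).1 Γ₁ hΓ₁
  have ht₂ := (hS Q₂ φ₂ x₂ hux₂).2 Γ₂ hΓ₂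
  obtain ⟨η₁, hη₁v, hη₁⟩ := ((Metric.tendsto_nhds.1 ht₁ ε hε).and self_mem_nhdsWithin).exists
  obtain ⟨η₂, hη₂v, hη₂⟩ := ((Metric.tendsto_nhds.1 ht₂ ε hε).and self_mem_nhdsWithin).exists
  replace hη₁ : 0 < η₁ := hη₁
  replace hη₂ : 0 < η₂ := hη₂
  -- moduli: `|F(η_{Qᵢ}) - F(η_R)| < ε`
  have hx₁I : crossRatio x₁ ∈ Icc (0 : ℝ) 1 :=
    Ioo_subset_Icc_self (ConformalRectangle.crossRatio_mem_Ioo_of_isUniformizing hux₁)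
  have hx₂I : crossRatio x₂ ∈ Icc (0 : ℝ) 1 :=
    Ioo_subset_Icc_self (ConformalRectangle.crossRatio_mem_Ioo_of_isUniformizing hux₂)
  have hcr₁ : |crossRatio x₁ - crossRatio x| ≤ θ / 2 := hmod₁ φ₁ x₁ hux₁
  have hcr₂ : |crossRatio x₂ - crossRatio x| ≤ θ / 2 := hmod₂ φ₂ x₂ hux₂
  have hF₁ : dist (RandomPlanarGeometry.cardyFunction (crossRatio x₁)) (RandomPlanarGeometry.cardyFunction (crossRatio x)) < ε :=
    hθF _ hx₁I _ hηI (by rw [Real.dist_eq]; linarith)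
  have hF₂ : dist (RandomPlanarGeometry.cardyFunction (crossRatio x₂)) (RandomPlanarGeometry.cardyFunction (crossRatio x)) < ε :=
    hθF _ hx₂I _ hηI (by rw [Real.dist_eq]; linarith)
  -- STUBS A, B: the deterministic inclusions at `η₁`, `η₂`
  have hinc₁ := hU R _ _ hgeo₁ Λ₁ hΛ₁ η₁ hη₁
  have hinc₂ := hL R _ _ hgeo₂ Λ₂ hΛ₂ η₂ hη₂
  -- the closed touch sets
  set K₁ : Set ℂ := cthickening η₁ (Q₁.arc 2) with hK₁
  set K₂ : Set ℂ := cthickening η₂ (Q₂.arc 1) with hK₂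
  have hK₁c : IsClosed K₁ := isClosed_cthickening
  have hK₂c : IsClosed K₂ := isClosed_cthickening
  -- eventual containments in the range events of the oriented interface classes
  have hev₁ : ∀ᶠ δ : ℝ in 𝓝[>] 0, discreteCrossing R.carrier δ (R.arc 0) (R.arc 2) ⊆
      {ω | ((Interface.bondInterfaceIn (Q₁.chord 0 1 (by decide)) (Λ₁ δ) ω).range ∩ K₁).Nonempty} := by
    filter_upwards [hinc₁] with δ hδ ω hω
    have h := hδ hω
    simp only [mem_setOf_eq] at h ⊢
    rwa [Interface.range_bondInterfaceIn]
  have hev₂ : ∀ᶠ δ : ℝ in 𝓝[>] 0, (discreteCrossing R.carrier δ (R.arc 0) (R.arc 2))ᶜ ⊆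
      {ω | ((Interface.bondInterfaceIn (Q₂.chord 0 3 (by decide)) (Λ₂ δ) ω).range ∩ K₂).Nonempty} := by
    filter_upwards [hinc₂] with δ hδ ω hω
    simp only [mem_setOf_eq]
    rw [Interface.range_bondInterfaceIn]
    by_contra hne
    rw [not_nonempty_iff_eq_empty] at hne
    exact hω (hδ (show ω ∈ {ω | Disjoint (range (medialExplorationCurve (Λ₂ δ) ω)) K₂} from
      disjoint_iff_inter_eq_empty.2 hne))
  -- STUB C: portmanteau
  have hpm₁ := hP _ Γ₁ hΓ₁.aemeasurable hmeas₁' hlaw₁' K₁ hK₁c _ hev₁ ε hε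
  have hpm₂ := hP _ Γ₂ hΓ₂.aemeasurable hmeas₂' hlaw₂' K₂ hK₂c _ hev₂ ε hε
  -- assemble
  rw [Real.dist_eq, abs_sub_lt_iff] at hη₁v hη₂v hF₁ hF₂
  filter_upwards [hpm₁, hpm₂] with δ h₁ h₂
  set C : Set (BondConfig (Site 2)) := discreteCrossing R.carrier δ (R.arc 0) (R.arc 2) with hC
  have hsum : 1 ≤ (bondPercolation (zdGraph 2) Percolation.half).real C +
      (bondPercolation (zdGraph 2) Percolation.half).real Cᶜ := by
    calc (1 : ℝ) = (bondPercolation (zdGraph 2) Percolation.half).real univ := probReal_univ.symm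
      _ = (bondPercolation (zdGraph 2) Percolation.half).real (C ∪ Cᶜ) := by rw [union_compl_self]
      _ ≤ _ := measureReal_union_le _ _
  have hp : bondDomainCrossingProb R δ = (bondPercolation (zdGraph 2) Percolation.half).real C := rfl
  rw [hp, Real.dist_eq, abs_sub_lt_iff]
  constructor <;> linarith

/-- **Collar-touch sandwich closes `SLESixFamiliesGiveCardy`** — the skeleton theorem: concludes the
crux BY NAME from the seven registered stubs (the only sorries of the file sit inside them). -/
theorem SLESixFamiliesGiveCardy_of :
    Summit.CriticalPhenomena.CardyFormulaZ2.Theses.CardyComplexCone.SLESixFamiliesGiveCardy :=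
  cardy_of_statements stub_upperFence stub_lowerRun stub_touchLimsup stub_sleSideTouch
    stub_collarDomains stub_modulusContinuity stub_smoothMarkFamilies

end Summit.CriticalPhenomena.CardyFormulaZ2.Cruxes.SLESixFamiliesGiveCardy.CollarTouchSandwich
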